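import Literature.Analysis.FluidPDE.LerayHopfDatumTorus
import HarnessLib

/-!
# Leray–Hopf solutions on the torus do not see the time-zero slice

Analysis/FluidPDE support file (all proved).  In the accepted `Torus.IsLerayHopfOn T ν f u₀ u` (Leray 1934 §III;
Galdi 2000, Def. 2.1) the value `u 0` of the velocity AT time zero is constrained only by `u 0 ∈ L²` and
`½‖u 0‖² ≤ ½‖u₀‖²` (the energy inequality from `0` at `t = 0`); the weak formulation, the energy class, the
energy inequalities at positive times, the weak continuity on `(0, T]`, the weak limit and the strong trace at
`0⁺` all live on `(0, T]`.  Hence: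

* `Torus.IsLerayHopfOn.congr_of_eqOn_Ioi` — if `v t = u t` for all `t > 0`, `v 0 ∈ L²` and
  `kineticEnergy (v 0) ≤ kineticEnergy u₀`, then `v` is again a Leray–Hopf solution with the same data;
* `Torus.IsLerayHopfOn.update_zero`, `Torus.IsGlobalLerayHopf.update_zero` — in particular one may NORMALISE
  `u 0 := u₀` (for an `L²` datum), after which the solution attains its datum pointwise at `t = 0`.

This normalisation is used by the Galilean change of frame (`LerayHopfGalileanTorus`), whose energy bookkeeping
at `t = 0` needs `u 0 = u₀`.

References: J. Leray, Acta Math. 63 (1934) §III; G. P. Galdi, *An introduction to the Navier–Stokes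
initial-boundary value problem* (2000), Def. 2.1.
-/

noncomputable section

open MeasureTheory Set Filter Topology Function
open scoped InnerProductSpace RealInnerProductSpace ENNReal NNReal

namespace Literature.Analysis.FluidPDE.Torus

open Literature.Analysis.FunctionSpaces Literature.Analysis.FunctionSpaces.Torus

variable {d : Type*} [Fintype d] [DecidableEq d]
variable {T ν : ℝ} {f u v : ℝ → UnitAddTorus d → EuclideanSpace ℝ d} {u₀ : UnitAddTorus d → EuclideanSpace ℝ d}

/-- **A Leray–Hopf solution may be changed at `t = 0`**: if `v t = u t` for every `t > 0`, the new time-zero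
slice `v 0` is square integrable and `½‖v 0‖² ≤ ½‖u₀‖²`, then `v` is a Leray–Hopf solution on `[0, T)` with the
same viscosity, force and datum (every clause of the definition lives on `(0, T]`, except `memLp` and
`energy_ineq_zero` at `t = 0`, which are the two hypotheses). [folklore] -/
theorem IsLerayHopfOn.congr_of_eqOn_Ioi (h : IsLerayHopfOn T ν f u₀ u) (hv : ∀ t, 0 < t → v t = u t)
    (hv0 : MemLp (v 0) 2 volume) (hE0 : kineticEnergy (v 0) ≤ kineticEnergy u₀) :
    IsLerayHopfOn T ν f u₀ v := by
  have hIoo : ∀ t ∈ Ioo 0 T, v t = u t := fun t ht => hv t ht.1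
  have hIoc : ∀ t ∈ Ioc 0 T, v t = u t := fun t ht => hv t ht.1
  -- interval work integrals over `(s, t]`, `0 ≤ s`
  have hwork : ∀ {s t : ℝ}, 0 ≤ s → s ≤ t →
      (∫ τ in s..t, ∫ x, ⟪f τ x, v τ x⟫) = ∫ τ in s..t, ∫ x, ⟪f τ x, u τ x⟫ := by
    intro s t hs hst
    rw [intervalIntegral.integral_of_le hst, intervalIntegral.integral_of_le hst]
    exact setIntegral_congr_fun measurableSet_Ioc fun τ hτ => by rw [hv τ (hs.trans_lt hτ.1)]
  -- dissipation over `(s, t)`, `0 ≤ s`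
  have hdiss : ∀ {s t : ℝ}, 0 ≤ s →
      (∫⁻ τ in Ioo s t, eGradNormSq (v τ)) = ∫⁻ τ in Ioo s t, eGradNormSq (u τ) := by
    intro s t hs
    exact setLIntegral_congr_fun measurableSet_Ioo fun τ hτ => by rw [hv τ (hs.trans_lt hτ.1)]
  refine ⟨h.weak.congr_of_eqOn_Ioo hIoo, ?_, ?_, ?_, ?_, ?_, ?_, ?_⟩
  · -- energy_bound
    obtain ⟨C, hC⟩ := h.energy_bound
    refine ⟨C, ?_⟩
    filter_upwards [hC, ae_restrict_mem measurableSet_Ioo] with t ht htI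
    rwa [hIoo t htI]
  · -- memLp
    intro t ht
    rcases ht.1.eq_or_lt with h0 | h0
    · rw [← h0]; exact hv0
    · rw [hv t h0]; exact h.memLp t ht
  · -- memL2Sobolev
    obtain ⟨h1, h2⟩ := h.memL2Sobolev
    refine ⟨?_, ?_⟩
    · filter_upwards [h1, ae_restrict_mem measurableSet_Ioo] with t ht htI
      simpa only [hIoo t htI] using ht
    · have e : eL2SobolevNorm 0 T 1 (fun t => EuclideanSpace.complexify ∘ v t) =
          eL2SobolevNorm 0 T 1 (fun t => EuclideanSpace.complexify ∘ u t) := by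
        unfold eL2SobolevNorm
        congr 1
        exact setLIntegral_congr_fun measurableSet_Ioo fun t ht => by dsimp only; rw [hIoo t ht]
      rw [e]; exact h2
  · -- energy_ineq_zero
    intro t ht
    rcases ht.1.eq_or_lt with h0 | h0
    · subst h0
      simp only [Ioo_self, Measure.restrict_empty, lintegral_zero_measure, ENNReal.toReal_zero, mul_zero,
        add_zero, intervalIntegral.integral_same]
      exact hE0
    · have h1 := h.energy_ineq_zero t ht
      rwa [← hv t h0, ← hdiss le_rfl, ← hwork le_rfl ht.1] at h1
  · -- energy_ineq_ae
    filter_upwards [h.energy_ineq_ae, ae_restrict_mem measurableSet_Ioo] with s hs hsI t ht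
    have h1 := hs t ht
    rwa [← hv t (hsI.1.trans_le ht.1), ← hv s hsI.1, ← hdiss hsI.1.le, ← hwork hsI.1.le ht.1] at h1
  · -- weak_continuous
    intro w hw
    obtain ⟨hc, hl⟩ := h.weak_continuous w hw
    refine ⟨hc.congr fun t ht => by simp only [hIoc t ht], hl.congr' ?_⟩
    filter_upwards [self_mem_nhdsWithin] with t ht
    simp only [hv t ht]
  · -- strong_initial
    refine h.strong_initial.congr' ?_
    filter_upwards [self_mem_nhdsWithin] with t ht
    simp only [hv t ht]

/-- **Normalising the time-zero slice**: for an `L²` datum, `Function.update u 0 u₀` is again a Leray–Hopf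
solution with the same data, and it attains the datum pointwise at `t = 0`. [folklore] -/
theorem IsLerayHopfOn.update_zero (h : IsLerayHopfOn T ν f u₀ u) (hu₀ : MemLp u₀ 2 volume) :
    IsLerayHopfOn T ν f u₀ (update u 0 u₀) :=
  h.congr_of_eqOn_Ioi (fun t ht => update_of_ne ht.ne' _ _) (by rw [update_self]; exact hu₀)
    (by rw [update_self])

/-- Global version of `IsLerayHopfOn.congr_of_eqOn_Ioi`. [folklore] -/
theorem IsGlobalLerayHopf.congr_of_eqOn_Ioi (h : IsGlobalLerayHopf ν f u₀ u) (hv : ∀ t, 0 < t → v t = u t)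
    (hv0 : MemLp (v 0) 2 volume) (hE0 : kineticEnergy (v 0) ≤ kineticEnergy u₀) :
    IsGlobalLerayHopf ν f u₀ v :=
  fun T hT => (h T hT).congr_of_eqOn_Ioi hv hv0 hE0

/-- **Normalising the time-zero slice of a global Leray–Hopf solution**: for an `L²` datum,
`Function.update u 0 u₀` is again a global Leray–Hopf solution with the same data. [folklore] -/
theorem IsGlobalLerayHopf.update_zero (h : IsGlobalLerayHopf ν f u₀ u) (hu₀ : MemLp u₀ 2 volume) :
    IsGlobalLerayHopf ν f u₀ (update u 0 u₀) :=
  fun T hT => (h T hT).update_zero hu₀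

end Literature.Analysis.FluidPDE.Torus
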